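import Summits.QuantumFields.BalabanUV.Gaps.EndDrawdownCooperatorExtremal

/-!
# Gaps / EndDrawdownLinearOrbitCriterion — THE ORBIT CRITERION: for a monotone cooperator `β_{k+1} = b_k + H(g_k)` (`H` continuous and
# non-decreasing on `]0,γ₀]`) `EndpointExistence` of ANY forward-generated construction is EQUIVALENT to a property of the deterministic backward
# orbits of the clamped step map (`EndDrawdownCooperatorExtremal.stepMap`): on every small box `]0,γ]` some terminal level `Y ≥ 1∕γ²` has ALL its
# backward orbits (every horizon `K`) above the clamp (`endpointExistence_coop_iff_orbits`).  With extremality this makes census row R83's «ONE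
# deterministic orbit condition» literal: **`endPossibleLin_iff_orbits`** — `EndPossibleLin b C γ₀` holds iff for all small `γ` there is `Y ≥ 1∕γ²`
# such that every solution `z` of `z_K = Y`, `F_i(z_i) = z_{i+1}` (`i < K`) satisfies `z_i ≥ 1∕γ²` (`i ≤ K`), for every `K`; no realization, no
# construction, no continuity letter appears on the right-hand side (cell pub-balaban-gaps, seat g1-p3 GEN 10, rows CAP ∕ tail ∕ (D4) «split ∕
# weakening»; this seat's own leaf; file 24 of «the one-loop interface of the END statement»)

HONEST FRAMING (cell rule, page 1 of everything): [folklore] bookkeeping over `EndDrawdownCooperatorExtremal` (orbits exist, are monotone in the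
target, dominate runs, and are runs); `EndPossibleLin` ∕ `EndpointExistence` are READINGS of the cell's END-grade statement over Bałaban-free data;
NOTHING of Bałaban's table is certified (NODE-O 0∕1, CAP coefficients 0); words ∕ odds of rows CAP ∕ tail ∕ (D4) ∕ (D1) UNCHANGED; 0∕6 binders;
one finite T⁴; NOT [I] Thm 2, NOT `BetaPertH`, NOT the continuum limit, NOT Clay.

CITATION HEADER (tags CONTEXT ONLY).  [I] = T. Bałaban, Commun. Math. Phys. **109** (1987) 249–301 [Balaban1987RG1]: (0.20) p. 256, Thm 2
p. 259 (first sentence), (2.12)–(2.14) p. 268.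
-/

namespace Summit.QuantumFields.BalabanUV.Gaps.EndDrawdownLinearOrbitCriterion

open Literature.MathematicalPhysics.QuantumFieldTheory.Balaban1983to89
open Literature.MathematicalPhysics.QuantumFieldTheory.Balaban1983to89.FlowStep
open Literature.MathematicalPhysics.QuantumFieldTheory.Balaban1983to89.FlowStepRuns
open Literature.MathematicalPhysics.QuantumFieldTheory.Balaban1983to89.DagBinding
open Summit.QuantumFields.BalabanUV.Gaps.EndDrawdownLinearRoad
open Summit.QuantumFields.BalabanUV.Gaps.EndDrawdownCooperatorExtremal

noncomputable section

variable {b : ℕ → ℝ} {H : ℝ → ℝ} {γ₀ : ℝ}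

/-- THE ORBIT PROPERTY of the cooperator `(b, H)` on the box `]0,γ]` at terminal level `Y`: every backward orbit of the clamped step map ending at
`Y`, of every horizon `K`, stays above the clamp `1∕γ²`. A property of `(b, H, γ, Y)` alone. [folklore] -/
def OrbitsAbove (b : ℕ → ℝ) (H : ℝ → ℝ) (γ Y : ℝ) : Prop :=
  ∀ (K : ℕ) (z : ℕ → ℝ), z K = Y → (∀ i, i < K → stepMap b H γ i (z i) = z (i + 1)) → ∀ i, i ≤ K → 1 / γ ^ 2 ≤ z i

/-- The orbit property is MONOTONE in the terminal level (orbits are monotone in the target, `backOrbit_mono`; `H` continuous and non-decreasing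
on `]0,γ]`, so that the orbit at the lower level exists). [folklore] -/
theorem orbitsAbove_mono {γ Y Y' : ℝ} (hγ : 0 < γ) (hHc : ContinuousOn H (Set.Ioc 0 γ)) (hHm : MonotoneOn H (Set.Ioc 0 γ))
    (h : OrbitsAbove b H γ Y) (hYY' : Y ≤ Y') : OrbitsAbove b H γ Y' := by
  intro K z' hzK' hz' i hi
  obtain ⟨z, hzK, hz⟩ := exists_backOrbit (b := b) hγ hHc hHm K Y
  exact (h K z hzK hz i hi).trans (backOrbit_mono hγ hHm hz hz' (by rw [hzK, hzK']; exact hYY') i hi)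

/-- **THE ORBIT CRITERION** · for the cooperator `β_{k+1} = b_k + H(g_k)` (`H` continuous and non-decreasing on `]0,γ₀]`) and ANY forward-generated
construction: `EndpointExistence ⟺ ∃ γ₂ > 0, ∀ γ ∈ ]0,γ₂], ∃ Y ≥ 1∕γ², OrbitsAbove b H γ Y`.  (⟹): at the target `g⋆(γ)` every orbit ending at
`1∕g⋆²` dominates the run E provides (`backOrbit_ge_traj`); (⟸): an orbit above the clamp is a run (`run_of_backOrbit`), smaller targets raise
the orbits. [cite: Balaban1987RG1, Thm 2 p.259 (first sentence) and (0.20) p.256] -/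
theorem endpointExistence_coop_iff_orbits (hγ₀ : 0 < γ₀) (hHc : ContinuousOn H (Set.Ioc 0 γ₀)) (hHm : MonotoneOn H (Set.Ioc 0 γ₀))
    {β : HBeta} (hβ : ∀ (k : ℕ) (p : Fin (k + 1) → ℝ), 0 < p (Fin.last k) → β k p = b k + H (p (Fin.last k)))
    {C : B12.Construction} (hgen : ForwardGenerated C β) :
    EndpointExistence C ↔ ∃ γ₂ : ℝ, 0 < γ₂ ∧ ∀ γ : ℝ, 0 < γ → γ ≤ γ₂ → ∃ Y : ℝ, 1 / γ ^ 2 ≤ Y ∧ OrbitsAbove b H γ Y := by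
  constructor
  · intro hE
    obtain ⟨γ₂, hγ₂, h⟩ := hE 0
    refine ⟨min γ₂ γ₀, lt_min hγ₂ hγ₀, fun γ hγ hγle => ?_⟩
    obtain ⟨gstar, hgstar, hg⟩ := h γ hγ (hγle.trans (min_le_left _ _))
    have hγγ₀ : γ ≤ γ₀ := hγle.trans (min_le_right _ _)
    have hsub : Set.Ioc 0 γ ⊆ Set.Ioc 0 γ₀ := fun x hx => ⟨hx.1, hx.2.trans hγγ₀⟩
    -- the target `g⋆` is reached, so `g⋆ ≤ γ`
    obtain ⟨g00, hI0, hK0⟩ := hg gstar hgstar le_rfl 0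
    have hgγ : gstar ≤ γ := by rw [← hK0]; exact (hI0 0 le_rfl).2
    refine ⟨1 / gstar ^ 2, one_div_le_one_div_of_le (pow_pos hgstar 2) (pow_le_pow_left₀ hgstar.le hgγ 2), fun K z hzK hz i hi => ?_⟩
    obtain ⟨g0, hI, hK⟩ := hg gstar hgstar le_rfl K
    have hdom := backOrbit_ge_traj hγ (hHm.mono hsub) hI (steps_dominated_of_coopRun hβ hgen ⟨K, 0, g0⟩ hI)
      (by rw [hzK, hK]) hz
    exact (one_div_le_one_div_of_le (pow_pos (hI i hi).1 2) (pow_le_pow_left₀ (hI i hi).1.le (hI i hi).2 2)).trans (hdom i hi)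
  · rintro ⟨γ₂, hγ₂, h⟩ m
    refine ⟨min γ₂ γ₀, lt_min hγ₂ hγ₀, fun γ hγ hγle => ?_⟩
    obtain ⟨Y, hY, hO⟩ := h γ hγ (hγle.trans (min_le_left _ _))
    have hγγ₀ : γ ≤ γ₀ := hγle.trans (min_le_right _ _)
    have hsub : Set.Ioc 0 γ ⊆ Set.Ioc 0 γ₀ := fun x hx => ⟨hx.1, hx.2.trans hγγ₀⟩
    have hYpos : 0 < Y := lt_of_lt_of_le (by positivity) hY
    refine ⟨1 / Real.sqrt Y, by positivity, fun g hg hgle K => ?_⟩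
    have hYg : Y ≤ 1 / g ^ 2 := by
      have h1 : g ^ 2 ≤ (1 / Real.sqrt Y) ^ 2 := pow_le_pow_left₀ hg.le hgle 2
      rw [div_pow, one_pow, Real.sq_sqrt hYpos.le] at h1
      calc Y = 1 / (1 / Y) := (one_div_one_div Y).symm
        _ ≤ 1 / g ^ 2 := one_div_le_one_div_of_le (pow_pos hg 2) h1
    have hgγ : g ≤ γ := by
      have h2 : g ^ 2 ≤ γ ^ 2 := (one_div_le_one_div (pow_pos hγ 2) (pow_pos hg 2)).mp (hY.trans hYg)
      exact (pow_le_pow_iff_left₀ hg.le hγ.le two_ne_zero).mp h2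
    obtain ⟨z, hzK, hz⟩ := exists_backOrbit (b := b) hγ (hHc.mono hsub) (hHm.mono hsub) K (1 / g ^ 2)
    have hA := orbitsAbove_mono hγ (hHc.mono hsub) (hHm.mono hsub) hO hYg K z hzK hz
    obtain ⟨g0, hI, hKend, -⟩ := run_of_backOrbit hβ hγ hgen hg hgγ m hzK hz hA
    exact ⟨g0, hI, hKend⟩

/-- **THE LINEAR ROAD AS AN ORBIT CONDITION** · `EndPossibleLin b C γ₀ ⟺ ∃ γ₂ > 0, ∀ γ ∈ ]0,γ₂], ∃ Y ≥ 1∕γ², OrbitsAbove b (C·) γ Y` (`0 ≤ C`,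
`0 < γ₀`): possibility of the END statement over the whole (AF-1) class is a property of the deterministic backward orbits of
`F_i(y) = y − b_i − C·ĝ_γ(y)` ALONE — no realization, no construction, no continuity letter on the right.
[cite: Balaban1987RG1, Thm 2 p.259 (first sentence) and (2.12)–(2.14) p.268] -/
theorem endPossibleLin_iff_orbits {C : ℝ} (hC : 0 ≤ C) (hγ₀ : 0 < γ₀) :
    EndPossibleLin b C γ₀ ↔
      ∃ γ₂ : ℝ, 0 < γ₂ ∧ ∀ γ : ℝ, 0 < γ → γ ≤ γ₂ → ∃ Y : ℝ, 1 / γ ^ 2 ≤ Y ∧ OrbitsAbove b (fun x => C * x) γ Y := by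
  rw [endPossibleLin_iff_modelOf hC hγ₀]
  exact endpointExistence_coop_iff_orbits hγ₀ (continuousOn_linHelp C γ₀) (monotoneOn_linHelp hC γ₀)
    (fun k _ hp => betaLin_of_pos b C k hp) (modelOf_forwardGenerated _)

/-- The box in the orbit condition is immaterial beyond smallness: the right-hand side with `γ₂` implies it with every `γ₂' ≤ γ₂`. [folklore] -/
theorem orbits_criterion_mono {C γ₂ γ₂' : ℝ} (hγ₂' : 0 < γ₂') (hle : γ₂' ≤ γ₂)
    (h : ∀ γ : ℝ, 0 < γ → γ ≤ γ₂ → ∃ Y : ℝ, 1 / γ ^ 2 ≤ Y ∧ OrbitsAbove b (fun x => C * x) γ Y) :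
    ∃ γ₃ : ℝ, 0 < γ₃ ∧ ∀ γ : ℝ, 0 < γ → γ ≤ γ₃ → ∃ Y : ℝ, 1 / γ ^ 2 ≤ Y ∧ OrbitsAbove b (fun x => C * x) γ Y :=
  ⟨γ₂', hγ₂', fun γ hγ hγle => h γ hγ (hγle.trans hle)⟩

end

end Summit.QuantumFields.BalabanUV.Gaps.EndDrawdownLinearOrbitCriterion
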